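import Literature.Computability.Complexity.ModpIsolationRelation
import Literature.Computability.Complexity.IsolationAdvice
import Literature.Computability.Complexity.SharpPClosure
import Literature.Computability.Complexity.PolyAdvicePH
import Literature.Computability.AlgebraicComplexity.BurgisserFiniteFields
import Literature.Computability.AlgebraicComplexity.BooleanPartVPFinite
import HarnessLib

/-!
# Bürgisser's Theorem 3.1 and Corollary 1.2(2): discharges of
`polyAdvice_NP_subset_polyAdvice_ModpNP` and `burgisser_collapse_of_VP_eq_VNP_finite`

Trunk T-CPLX-ALG. Sibling proof file of `BurgisserFiniteFields.lean` (and, through it, of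
`ValiantBooleanBridge.lean`, pnp.S26). It closes the decomposition of
`Literature.Computability.AlgebraicComplexity.burgisser_collapse_of_VP_eq_VNP_finite k`
(Bürgisser, *Cook's versus Valiant's hypothesis*, TCS 235 (2000), Cor. 1.2(2), p. 74: "If
Valiant's hypothesis were false over a finite field `k` of characteristic `p`, then we had
`NC²/poly = P/poly = NP/poly = Mod_pNP/poly = PH/poly`"; book: Bürgisser 2000, Cor. 4.6(2)):

* **Theorem 3.1** (p. 77: "For a prime `p` we have `NP/poly ⊆ Mod_pNP/poly`"), proof pp. 78–79,
  is proved as `polyAdvice_NP_subset_polyAdvice_ModpNP_holds` from `NP ⊆ Mod_pNP/poly`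
  (`NP_subset_polyAdvice_ModpNP`): the mathematics — Valiant–Vazirani isolation in the coin model,
  Adleman's union bound giving `t = 6n + 1` isolating seeds as advice, the counting of
  Lemma 3.2 and the arithmetic `1 + ∏ (p − 1 + #ψⱼ) mod p` — is `IsolationAdvice.lean`; the
  polynomial-time relation whose witness count is `1 + ∏_{(j,k)} (p − 1 + Y_{j,k}(x))` and the
  exact-length normal form of `NP` verifiers are `ModpIsolationRelation.lean`; idempotence of the
  advice operator on the Karp-closed class `Mod_pNP` is `SharpPClosure.lean`;
* **the target** `burgisser_collapse_of_VP_eq_VNP_finite_holds` is then the proved assembly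
  `burgisser_collapse_of_VP_eq_VNP_finite_of_facts` (`BurgisserFiniteFields.lean`, proof of
  Cor. 1.2 on p. 79) fed with Thm. 3.1, (B3) `booleanPart_VP_NC_two_of_finite_holds`
  (`BooleanPartVPFinite.lean`, §5 (B)) and the PH step
  `polyAdvice_P_eq_polyAdvice_PH_of_polyAdvice_P_eq_polyAdvice_NP` (`PolyAdvicePH.lean`).

Differences from the printed proof, all on the safe side: Bürgisser reduces cnfs by Cook's theorem
and maps `ψ ↦ φ` in nonuniform polynomial time; here the verifier relation of the `NP` language is
used directly (as in the tree's proofs of (A2)/(B2)), the Valiant–Vazirani step uses the affine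
hash family with the tree's constant `1/8` at the good level instead of `1/(4n)` over all levels
(the product over the odd number `t · Lv` of (seed, level) pairs replaces Bürgisser's product over
`q` seeds), and the advice consists of `t = 6n + 1` seeds (`2ⁿ 7ᵗ < 8ᵗ`).

## References

* P. Bürgisser, *Cook's versus Valiant's hypothesis*, Theoret. Comput. Sci. 235 (2000) 71–88:
  Cor. 1.2(2) (p. 74), §2 (p. 75), Thm. 3.1 and Lemma 3.2 (pp. 77–78), proofs pp. 78–79.
* P. Bürgisser, *Completeness and Reduction in Algebraic Complexity Theory*, Springer 2000,
  Thm. 4.5, Cor. 4.6(2).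
* L. G. Valiant, V. V. Vazirani, *NP is as easy as detecting unique solutions*, Theoret. Comput.
  Sci. 47 (1986) 85–93; L. Adleman, *Two theorems on random polynomial time*, FOCS 1978.
* R. M. Karp, R. J. Lipton, *Turing machines that take advice*, Enseign. Math. 28 (1982).
-/

noncomputable section

namespace Literature.Computability.AlgebraicComplexity

open _root_.Computability Polynomial Literature.Computability.Complexity
  Literature.Computability.Complexity.Nondeterministic Literature.Computability.Complexity.Classes
  Literature.Computability.Complexity.Brick Literature.Computability.Complexity.OracleCompose
  Literature.Computability.Complexity.Stockmeyer

universe u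

/-- The length of a coded list of strings of a common length `ℓ`. [folklore] -/
theorem length_body_of_forall_length_eq {ℓ : ℕ} : ∀ l : List (List Bool),
    (∀ a ∈ l, a.length = ℓ) → (body l).length = l.length * (2 * ℓ + 2)
  | [], _ => by simp
  | a :: l, h => by
    rw [body_cons, length_boolPair, h a (by simp),
      length_body_of_forall_length_eq l fun b hb => h b (by simp [hb]), List.length_cons]
    ring

/-- A level count is at most the number of witnesses. [folklore] -/
theorem levelCount_le_countWitnesses (R : Language Bool) (m : ℕ) (x u : List Bool) (k : ℕ) :
    levelCount R m x u k ≤ countWitnesses R m x := by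
  rw [levelCount_eq_zeroCount, ← card_witnessSet]
  exact AffineHash.zeroCount_le _ _

/-- **`NP ⊆ Mod_pNP/poly` for a prime `p`** (the core of Bürgisser 2000 TCS, Thm. 3.1, p. 77,
proof pp. 78–79): for `L ∈ NP` with exact-length verifier `R₀` (`x ∈ L ↔ #R₀(x) > 0`,
`exists_pos_countWitnesses_iff_of_mem_NP`), the advice for length `n` is
`⟨1^m, ⟨1^t, ⟨u₀, …⟩⟩⟩` with `t = 6n + 1` isolating seeds (`exists_isolating_seeds`: for every
`x ∈ L ∩ {0,1}ⁿ` some seed `uⱼ` and level `k ≤ m + 2` have exactly one `R₀`-witness of `x` hashed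
to zero — Valiant–Vazirani plus Adleman), and the `Mod_pNP` language is `{w | φ(w) ≡ 1 mod p}` for
the `#P` function `φ` counting the witnesses of the isolation relation `exists_isolationRel`
(Lemma 3.2(4): `φ = 1 + ∏_{(j,k)} (p − 1 + Y_{j,k}(x))` over the odd number `t · Lv` of pairs);
`x ∉ L ⇒` all `Y = 0 ⇒ φ ≡ 1 + (−1)^{t·Lv} ≡ 0`, `x ∈ L ⇒` some `Y_{j,k}(x) = 1 ⇒ φ ≡ 1`
(`succ_prod_mod_eq_zero/one`). [cite: Burgisser2000TCS, Thm. 3.1 p. 77, proof pp. 78–79] [cite: ValiantVazirani1986] [cite: Adleman1978] -/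
theorem NP_subset_polyAdvice_ModpNP {p : ℕ} (hp : p.Prime) : NP ⊆ polyAdvice (ModpNP p) := by
  intro L hL
  obtain ⟨R₀, hR₀, q, hq⟩ := exists_pos_countWitnesses_iff_of_mem_NP hL
  obtain ⟨R'', hR'', hcount⟩ := exists_isolationRel hR₀ (p - 1)
  have hp2 : 2 ≤ p := hp.two_le
  -- isolating seeds for every input length (`m = q(n)` witness bits, `t = 6n + 1` seeds of
  -- `ℓ = (m + 2)(m + 1)` coins)
  have hseeds := fun n : ℕ => exists_isolating_seeds R₀ (q.eval n) n (6 * n + 1)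
    ((q.eval n + 2) * (q.eval n + 1)) (two_pow_mul_seven_pow_lt n) le_rfl
  choose us hus using hseeds
  -- the advice strings
  set adv : ℕ → List Bool := fun n => boolPair (ones (q.eval n))
    (boolPair (ones (6 * n + 1)) (body (List.ofFn fun j => (us n j).toList))) with hadv
  -- the `#P` function: witnesses of `R''` of length `P''(|w|)`, `P''(s) = s (s + 4) (s + p) + 1`
  set φ : List Bool → ℕ := fun w =>
    countWitnesses R'' ((X * (X + 4) * (X + Polynomial.C p) + 1 : ℕ[X]).eval w.length) w with hφ
  have hφP : φ ∈ SharpP := ⟨R'', hR'', X * (X + 4) * (X + Polynomial.C p) + 1, fun w => rfl⟩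
  refine ⟨{w | φ w % p = 1}, ⟨φ, hφP, fun w => Iff.rfl⟩, adv,
    2 * q + 2 + (2 * (6 * X + 1) + 2 + (6 * X + 1) * (2 * ((q + 2) * (q + 1)) + 2)),
    fun n => ?_, fun x => ?_⟩
  · -- the advice has polynomial length
    have hbody := length_body_of_forall_length_eq (ℓ := (q.eval n + 2) * (q.eval n + 1))
      (List.ofFn fun j => (us n j).toList) (by simp)
    rw [List.length_ofFn] at hbody
    simp only [hadv, length_boolPair, List.length_replicate, hbody, eval_add, eval_mul, eval_ofNat,
      eval_X, eval_one]
    exact le_of_eq (by ring)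
  · -- the semantics, at an input `x` of length `n`
    obtain ⟨n, hn⟩ : ∃ n, x.length = n := ⟨_, rfl⟩
    rw [hn]
    change x ∈ L ↔ φ (boolPair x (adv n)) % p = 1
    have hqx : x ∈ L ↔ 0 < countWitnesses R₀ (q.eval n) x := by rw [hq x, hn]
    obtain ⟨usl, husl⟩ : ∃ l : List (List Bool), l = List.ofFn fun j => (us n j).toList := ⟨_, rfl⟩
    have hlen_usl : usl.length = 6 * n + 1 := by rw [husl, List.length_ofFn]
    have hadvn : adv n = boolPair (ones (q.eval n)) (boolPair (ones usl.length) (body usl)) := by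
      simp only [hadv, husl, List.length_ofFn]
    obtain ⟨Lv, hLv⟩ : ∃ Lv, Lv = 2 * ((q.eval n + 3) / 2) + 1 := ⟨_, rfl⟩
    -- the nominal witness length is large enough
    have hM : usl.length * (2 * ((q.eval n + 3) / 2) + 1) * (q.eval n + (p - 1)) + 1 ≤
        ((X * (X + 4) * (X + Polynomial.C p) + 1 : ℕ[X])).eval (boolPair x (adv n)).length := by
      have hev : ((X * (X + 4) * (X + Polynomial.C p) + 1 : ℕ[X])).eval (boolPair x (adv n)).length =
          (boolPair x (adv n)).length * ((boolPair x (adv n)).length + 4) *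
            ((boolPair x (adv n)).length + p) + 1 := by
        simp [eval_add, eval_mul]
      rw [hev, hlen_usl]
      have htz : 6 * n + 1 ≤ (boolPair x (adv n)).length := by
        rw [hadvn, hlen_usl]; simp only [length_boolPair, List.length_replicate]; omega
      have hmz : q.eval n ≤ (boolPair x (adv n)).length := by
        rw [hadvn]; simp only [length_boolPair, List.length_replicate]; omega
      have h1 : (6 * n + 1) * (2 * ((q.eval n + 3) / 2) + 1) ≤
          (boolPair x (adv n)).length * ((boolPair x (adv n)).length + 4) := Nat.mul_le_mul htz (by omega)
      exact Nat.add_le_add_right (Nat.mul_le_mul h1 (by omega)) 1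
    have hφz : φ (boolPair x (adv n)) = 1 + ∏ i ∈ Finset.range (usl.length * Lv),
        (p - 1 + levelCount R₀ (q.eval n) x (usl.getD (i / Lv) []) (i % Lv)) := by
      have h := hcount x (q.eval n) usl _ hM
      rw [← hLv, ← hadvn] at h
      exact h
    rw [hφz, hlen_usl]
    have hLvodd : Odd ((6 * n + 1) * Lv) :=
      Odd.mul ⟨3 * n, by ring⟩ ⟨(q.eval n + 3) / 2, hLv⟩
    constructor
    · -- `x ∈ L`: some seed isolates a witness, its factor is `p`
      intro hxL
      obtain ⟨j, k, hk, hjk⟩ := hus n x hn (hqx.1 hxL)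
      have hkLv : k < Lv := by rw [hLv]; omega
      have hLvpos : 0 < Lv := by rw [hLv]; omega
      have hi : Lv * j.val + k < (6 * n + 1) * Lv := by
        have hj := j.isLt
        calc Lv * j.val + k < Lv * j.val + Lv := by omega
          _ = Lv * (j.val + 1) := by ring
          _ ≤ Lv * (6 * n + 1) := Nat.mul_le_mul_left _ hj
          _ = (6 * n + 1) * Lv := mul_comm _ _
      refine succ_prod_mod_eq_one hp2
        (c := fun i => levelCount R₀ (q.eval n) x (usl.getD (i / Lv) []) (i % Lv)) hi ?_
      show levelCount R₀ (q.eval n) x (usl.getD ((Lv * j.val + k) / Lv) []) ((Lv * j.val + k) % Lv) = 1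
      rw [Nat.mul_add_div hLvpos, Nat.div_eq_of_lt hkLv, add_zero, Nat.mul_add_mod,
        Nat.mod_eq_of_lt hkLv]
      have hget : usl.getD j.val [] = (us n j).toList := by
        rw [husl, List.getD_eq_getElem?_getD, List.getElem?_ofFn]
        have hj : j.val ≤ 6 * n := Nat.le_of_lt_succ j.isLt
        simp [hj]
      rw [hget]
      exact hjk
    · -- `x ∉ L`: all counts vanish, `φ ≡ 1 + (−1)^{t·Lv} ≡ 0`
      intro h1
      by_contra hxL
      have h0 : countWitnesses R₀ (q.eval n) x = 0 := Nat.le_zero.mp (Nat.not_lt.mp (hqx.not.1 hxL))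
      have hzero := succ_prod_mod_eq_zero hp2 hLvodd
        (c := fun i => levelCount R₀ (q.eval n) x (usl.getD (i / Lv) []) (i % Lv)) fun i _ =>
          Nat.eq_zero_of_le_zero ((levelCount_le_countWitnesses R₀ (q.eval n) x _ _).trans h0.le)
      beta_reduce at hzero
      omega

/-- **Discharge of Theorem 3.1** `polyAdvice_NP_subset_polyAdvice_ModpNP` (Bürgisser 2000 TCS,
Thm. 3.1, p. 77: "For a prime `p` we have `NP/poly ⊆ Mod_pNP/poly`"): from
`NP ⊆ Mod_pNP/poly` (`NP_subset_polyAdvice_ModpNP`) by monotonicity and idempotence of the advice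
operator on the Karp-closed class `Mod_pNP` (`polyAdvice_polyAdvice_subset`,
`preimage_mem_modCount`). Users are fed `polyAdvice_NP_subset_polyAdvice_ModpNP_holds`.
[cite: Burgisser2000TCS, Thm. 3.1 p. 77, proof pp. 78–79] [cite: ValiantVazirani1986] [cite: Adleman1978] -/
theorem polyAdvice_NP_subset_polyAdvice_ModpNP_holds : polyAdvice_NP_subset_polyAdvice_ModpNP := by
  intro p hp
  calc polyAdvice NP ⊆ polyAdvice (polyAdvice (ModpNP p)) :=
      polyAdvice_mono (NP_subset_polyAdvice_ModpNP hp)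
    _ ⊆ polyAdvice (ModpNP p) :=
      polyAdvice_polyAdvice_subset fun L hL f hf => preimage_mem_modCount p hL hf

/-- **Discharge of pnp.S26 (finite fields)**: `burgisser_collapse_of_VP_eq_VNP_finite k`
(Bürgisser 2000 TCS, Cor. 1.2(2), p. 74; book Cor. 4.6(2): `VP_k = VNP_k` over a finite field `k`
implies `NC²/poly = PH/poly`), assembled by `burgisser_collapse_of_VP_eq_VNP_finite_of_facts`
from the three discharged facts: Thm. 3.1 (`polyAdvice_NP_subset_polyAdvice_ModpNP_holds`),
(B3) `BP(VP_k) ⊆ FNC²/poly` (`booleanPart_VP_NC_two_of_finite_holds`, `BooleanPartVPFinite.lean`)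
and the PH step (`polyAdvice_P_eq_polyAdvice_PH_of_polyAdvice_P_eq_polyAdvice_NP`,
`PolyAdvicePH.lean`). [cite: Burgisser2000TCS, Cor. 1.2(2) p. 74 and its proof p. 79] [cite: Burgisser2000, Thm. 4.5 and Cor. 4.6(2)] -/
theorem burgisser_collapse_of_VP_eq_VNP_finite_holds (k : Type u) [Field k] :
    burgisser_collapse_of_VP_eq_VNP_finite k :=
  burgisser_collapse_of_VP_eq_VNP_finite_of_facts polyAdvice_NP_subset_polyAdvice_ModpNP_holds
    (booleanPart_VP_NC_two_of_finite_holds k)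
    polyAdvice_P_eq_polyAdvice_PH_of_polyAdvice_P_eq_polyAdvice_NP

/-- **Discharge of the PH step** `polyAdvice_PH_eq_of_polyAdvice_NP_eq` (Bürgisser 2000 TCS,
p. 79, proof of Cor. 1.2: "It is well-known that `P = NP` implies `P = PH` (cf. [12]). A similar
argument shows that `P/poly = NP/poly` implies `P/poly = PH/poly`"; [12] = Johnson's catalogue,
the advice classes being Karp–Lipton's): the "similar argument" is carried out in
`PolyAdvicePH.lean` — from `polyAdvice P = polyAdvice NP` one gets
`NP ⊆ NP/poly = P/poly-advice = P/poly` (`NP_subset_polyAdvice_NP'`,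
`PPoly_eq_polyAdvice_P_holds`, Arora–Barak Thm. 6.18), then by induction on the level
`Σₖ₊₁ᵖ = ∃ᵖ·coΣₖᵖ ⊆ ∃ᵖ·(P/poly) ⊆ NP/poly ⊆ (P/poly)/poly = P/poly`
(`polyExists_PPoly_subset_polyAdvice_NP`, `PH_subset_PPoly_of_NP_subset_PPoly`), whence
`PH/poly = P/poly-advice` (`polyAdvice_PH_eq_polyAdvice_P_of_NP_subset_PPoly`); the statement of
the fact is literally `polyAdvice_P_eq_polyAdvice_PH_of_polyAdvice_P_eq_polyAdvice_NP`. Users are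
fed `polyAdvice_PH_eq_of_polyAdvice_NP_eq_holds`.
[cite: Burgisser2000TCS, p. 79 proof of Cor. 1.2] [cite: KarpLipton1980] -/
theorem polyAdvice_PH_eq_of_polyAdvice_NP_eq_holds : polyAdvice_PH_eq_of_polyAdvice_NP_eq :=
  fun h => polyAdvice_P_eq_polyAdvice_PH_of_polyAdvice_P_eq_polyAdvice_NP h

end Literature.Computability.AlgebraicComplexity
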